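import Mathlib
import Summits.MatrixMultiplication.MatrixMultiplication.Theorems.SoloBlindFamTables
import Summits.MatrixMultiplication.MatrixMultiplication.Theorems.SoloBlindPresenceReduction

/-!
# The type model, preliminaries (solo-blind programme, K3.35 step 1e, part 1)

Bookkeeping for the soundness proof of the per-family type oracle of `SoloBlindFamTables`:
base-`3` codes of type vectors and their digits, the slot conventions (block slots `2q`, ambient
slots `2q+1`) of the usability / counting / hitting specs, the dyadic weight bound, bitmasks versus
subsets of the outside points (`soloBlindDecSet` is a bijection from `[0, 2^m)` onto the powerset),
the exact presence family of a target as a list of bitmasks, the MASS OVER BITMASKS formula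
(`soloBlind_mass_eq_sum_masks`, from `soloBlind_mass_union_powerset`), and sums over
"outside part plus block part".
-/

namespace Summit.MatrixMultiplication.MatrixMultiplication.Theorems

open Finset Module

/-- The vector `(h (x 0), …, h (x (m-1)), τ)`. -/
def soloBlindVec {G : Type*} {ι : Type*} (h : ι → G) {m : ℕ} (x : Fin m ↪ ι) (τ : G) :
    Fin (m + 1) → G :=
  Fin.snoc (α := fun _ => G) (fun a => h (x a)) τ

/-- Last entry of the vector. -/
theorem soloBlindVec_last {G : Type*} {ι : Type*} (h : ι → G) {m : ℕ} (x : Fin m ↪ ι) (τ : G) :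
    soloBlindVec h x τ (Fin.last m) = τ := by
  simp [soloBlindVec]

/-- Initial entries of the vector. -/
theorem soloBlindVec_castSucc {G : Type*} {ι : Type*} (h : ι → G) {m : ℕ} (x : Fin m ↪ ι) (τ : G)
    (a : Fin m) :
    soloBlindVec h x τ a.castSucc = h (x a) := by
  simp [soloBlindVec]

variable {G : Type*} [AddCommGroup G] [DecidableEq G] {ι : Type*} [DecidableEq ι]

/-! ## Arithmetic of slots and codes -/

/-- Base-`3` code of a type vector. -/
def soloBlindTyCode {m : ℕ} (t : Fin (m + 1) → ZMod 3) : ℕ :=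
  ((finFunctionFinEquiv t : Fin (3 ^ (m + 1))) : ℕ)

/-- Codes are below `3^(m+1)`. -/
theorem soloBlindTyCode_lt {m : ℕ} (t : Fin (m + 1) → ZMod 3) : soloBlindTyCode t < 3 ^ (m + 1) :=
  Fin.is_lt _

/-- Digits of the code are the entries of the type vector. -/
theorem soloBlindDig_tyCode {m : ℕ} (t : Fin (m + 1) → ZMod 3) (a : Fin (m + 1)) :
    soloBlindDig (soloBlindTyCode t) a = t a := by
  have e := finFunctionFinEquiv_symm_apply_val (finFunctionFinEquiv t) a
  rw [Equiv.symm_apply_apply] at e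
  unfold soloBlindDig soloBlindTyCode
  rw [← e]
  exact ZMod.natCast_zmod_val (t a)

/-- Usability of a block slot. -/
theorem soloBlind_okSpec_block (m q M : ℕ) :
    soloBlindOkSpec m (2 * q) M = decide (soloBlindResid m q M ≠ 2) := by
  have h1 : ¬ (2 * q) % 2 = 1 := by omega
  have h2 : 2 * q / 2 = q := by omega
  simp only [soloBlindOkSpec, h1, h2, if_false]

/-- Usability of an ambient slot. -/
theorem soloBlind_okSpec_amb (m q M : ℕ) :
    soloBlindOkSpec m (2 * q + 1) M = decide (soloBlindResid m q M = 0) := by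
  have h1 : (2 * q + 1) % 2 = 1 := by omega
  have h2 : (2 * q + 1) / 2 = q := by omega
  simp only [soloBlindOkSpec, h1, h2, if_true]

/-- A counting slot is a block slot with residue `1`. -/
theorem soloBlind_r1Spec_true {m k M : ℕ} (h : soloBlindR1Spec m k M = true) :
    k % 2 = 0 ∧ soloBlindResid m (k / 2) M = 1 := by
  unfold soloBlindR1Spec at h
  rw [Bool.and_eq_true, decide_eq_true_eq, decide_eq_true_eq] at h
  exact h

/-- Hitting a `zsf` constraint with a block slot. -/
theorem soloBlind_hitSpec_block_lo {m c : ℕ} (q : ℕ) (hc : c + 1 < 2 ^ m) :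
    soloBlindHitSpec m (2 * q) c = decide (soloBlindTSum m q (c + 1) false = 1) := by
  have h1 : ¬ (2 * q) % 2 = 1 := by omega
  have h2 : 2 * q / 2 = q := by omega
  simp only [soloBlindHitSpec, hc, h1, h2, if_true, if_false]

/-- Hitting a `zsf` constraint with an ambient slot. -/
theorem soloBlind_hitSpec_amb_lo {m c : ℕ} (q : ℕ) (hc : c + 1 < 2 ^ m) :
    soloBlindHitSpec m (2 * q + 1) c = decide (soloBlindTSum m q (c + 1) false ≠ 0) := by
  have h1 : (2 * q + 1) % 2 = 1 := by omega
  have h2 : (2 * q + 1) / 2 = q := by omega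
  simp only [soloBlindHitSpec, hc, h1, h2, if_true]

/-- Hitting an `H` constraint with a block slot. -/
theorem soloBlind_hitSpec_block_hi {m c : ℕ} (q : ℕ) (hc : ¬ c + 1 < 2 ^ m) :
    soloBlindHitSpec m (2 * q) c = decide (soloBlindTSum m q (c + 1 - 2 ^ m) true = 1) := by
  have h1 : ¬ (2 * q) % 2 = 1 := by omega
  have h2 : 2 * q / 2 = q := by omega
  simp only [soloBlindHitSpec, hc, h1, h2, if_false]

/-- Hitting an `H` constraint with an ambient slot. -/
theorem soloBlind_hitSpec_amb_hi {m c : ℕ} (q : ℕ) (hc : ¬ c + 1 < 2 ^ m) :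
    soloBlindHitSpec m (2 * q + 1) c = decide (soloBlindTSum m q (c + 1 - 2 ^ m) true ≠ 0) := by
  have h1 : (2 * q + 1) % 2 = 1 := by omega
  have h2 : (2 * q + 1) / 2 = q := by omega
  simp only [soloBlindHitSpec, hc, h1, h2, if_true, if_false]

/-- Scaled dyadic weights are dominated by the truncated powers of two. -/
theorem soloBlind_halfPow_mul_le (S e : ℕ) : (1 / 2 : ℚ) ^ e * 2 ^ S ≤ (soloBlindPow2T S e : ℚ) := by
  unfold soloBlindPow2T
  split_ifs with he
  · push_cast
    have h2 : (2 : ℚ) ^ S = 2 ^ e * 2 ^ (S - e) := by rw [← pow_add, Nat.add_sub_cancel' he]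
    rw [h2, ← mul_assoc, ← mul_pow]
    norm_num
  · push_cast
    have hS : S ≤ e := by omega
    have h2 : (1 / 2 : ℚ) ^ e = (1 / 2) ^ S * (1 / 2) ^ (e - S) := by
      rw [← pow_add, Nat.add_sub_cancel' hS]
    rw [h2, mul_comm, ← mul_assoc, ← mul_pow]
    norm_num
    exact pow_le_one₀ (by norm_num) (by norm_num)

/-! ## Bitmasks -/

/-- Bitmasks below `2^m` are determined by their decoded sets. -/
theorem soloBlindDecSet_inj {m M₁ M₂ : ℕ} (h₁ : M₁ < 2 ^ m) (h₂ : M₂ < 2 ^ m)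
    (he : soloBlindDecSet m M₁ = soloBlindDecSet m M₂) : M₁ = M₂ := by
  apply Nat.eq_of_testBit_eq
  intro i
  by_cases hi : i < m
  · have key := Finset.ext_iff.mp he ⟨i, hi⟩
    simp only [soloBlindDecSet, Finset.mem_filter, Finset.mem_univ, true_and] at key
    revert key
    cases M₁.testBit i <;> cases M₂.testBit i <;> simp
  · push Not at hi
    rw [Nat.testBit_eq_false_of_lt (lt_of_lt_of_le h₁ (Nat.pow_le_pow_right (by norm_num) hi)),
      Nat.testBit_eq_false_of_lt (lt_of_lt_of_le h₂ (Nat.pow_le_pow_right (by norm_num) hi))]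

/-- A nonzero bitmask decodes to a nonempty set. -/
theorem soloBlindDecSet_nonempty {m M : ℕ} (h0 : M ≠ 0) (hM : M < 2 ^ m) :
    (soloBlindDecSet m M).Nonempty := by
  obtain ⟨i, hi, -⟩ := Nat.exists_most_significant_bit h0
  have him : i < m := by
    by_contra hc
    push Not at hc
    rw [Nat.testBit_eq_false_of_lt (lt_of_lt_of_le hM (Nat.pow_le_pow_right (by norm_num) hc))] at hi
    exact Bool.false_ne_true hi
  exact ⟨⟨i, him⟩, by simp [soloBlindDecSet, hi]⟩

/-- Membership in a decoded set. -/
theorem soloBlind_mem_decSet {m M : ℕ} (a : Fin m) : a ∈ soloBlindDecSet m M ↔ M.testBit a = true := by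
  simp [soloBlindDecSet]

omit [DecidableEq ι] in
/-- Every subset of the outside points is decoded by a bitmask below `2^m`. -/
theorem soloBlind_exists_mask {m : ℕ} (x : Fin m ↪ ι) {C : Finset ι} (hC : C ⊆ Finset.univ.map x) :
    ∃ M < 2 ^ m, (soloBlindDecSet m M).map x = C := by
  have hsurj := Finset.surj_on_of_inj_on_of_card_le (s := Finset.range (2 ^ m))
    (t := (Finset.univ.map x).powerset) (fun M _ => (soloBlindDecSet m M).map x)
    (fun M _ => Finset.mem_powerset.mpr (Finset.map_subset_map.mpr (Finset.subset_univ _)))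
    (fun M₁ M₂ h₁ h₂ he => soloBlindDecSet_inj (Finset.mem_range.mp h₁) (Finset.mem_range.mp h₂)
      (Finset.map_injective x he))
    (by rw [Finset.card_powerset, Finset.card_map, Finset.card_univ, Fintype.card_fin, Finset.card_range])
  obtain ⟨M, hM, hMC⟩ := hsurj C (Finset.mem_powerset.mpr hC)
  exact ⟨M, Finset.mem_range.mp hM, hMC.symm⟩

/-! ## The exact family and the mass over bitmasks -/

/-- The exact presence family of `τ` over the outside points `x`, as a list of bitmasks. -/
def soloBlindExactFam (h : ι → G) (B : Finset ι) {m : ℕ} (x : Fin m ↪ ι) (τ : G) : List ℕ :=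
  (List.range (2 ^ m)).filter fun M =>
    decide ((soloBlindSeqRepAll h B (τ - ∑ a ∈ soloBlindDecSet m M, h (x a))).Nonempty)

omit [DecidableEq ι] in
/-- Membership in the exact family. -/
theorem soloBlind_mem_exactFam {h : ι → G} {B : Finset ι} {m : ℕ} {x : Fin m ↪ ι} {τ : G} {M : ℕ} :
    M ∈ soloBlindExactFam h B x τ ↔
      M < 2 ^ m ∧ (soloBlindSeqRepAll h B (τ - ∑ a ∈ soloBlindDecSet m M, h (x a))).Nonempty := by
  unfold soloBlindExactFam
  rw [List.mem_filter, List.mem_range, decide_eq_true_eq]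

omit [DecidableEq ι] in
/-- The exact family is a sublist of `range (2^m)`. -/
theorem soloBlind_exactFam_sublist (h : ι → G) (B : Finset ι) {m : ℕ} (x : Fin m ↪ ι) (τ : G) :
    (soloBlindExactFam h B x τ).Sublist (List.range (2 ^ m)) := List.filter_sublist

omit [DecidableEq ι] in
/-- Presence of a decoded set is membership of its mask in the exact family. -/
theorem soloBlind_present_map_iff (h : ι → G) (B : Finset ι) {m : ℕ} (x : Fin m ↪ ι) (τ : G) (M : ℕ) :
    soloBlindPresent h B τ ((soloBlindDecSet m M).map x) ↔
      (soloBlindSeqRepAll h B (τ - ∑ a ∈ soloBlindDecSet m M, h (x a))).Nonempty := by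
  unfold soloBlindPresent
  rw [Finset.sum_map]

omit [DecidableEq ι] in
/-- Outside points avoid the block: the union is disjoint. -/
theorem soloBlind_disjoint_map {B : Finset ι} {m : ℕ} (x : Fin m ↪ ι) (hxB : ∀ a, x a ∉ B) :
    Disjoint B (Finset.univ.map x) := by
  rw [Finset.disjoint_right]
  intro y hy
  rw [Finset.mem_map] at hy
  obtain ⟨a, -, rfl⟩ := hy
  exact hxB a

/-- MASS OVER BITMASKS: `mass(τ; B ∪ X) = ∑_{M < 2^m} 2^{-|M|} · mass(τ - ∑_{a ∈ M} h (x a); B)`. -/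
theorem soloBlind_mass_eq_sum_masks (h : ι → G) (B : Finset ι) {m : ℕ} (x : Fin m ↪ ι)
    (hxB : ∀ a, x a ∉ B) (τ : G) :
    soloBlindMass h (B ∪ Finset.univ.map x) τ = ∑ M ∈ Finset.range (2 ^ m),
      (1 / 2 : ℚ) ^ (soloBlindDecSet m M).card *
        soloBlindMass h B (τ - ∑ a ∈ soloBlindDecSet m M, h (x a)) := by
  rw [soloBlind_mass_union_powerset h (soloBlind_disjoint_map x hxB) τ]
  symm
  refine Finset.sum_bij (fun M _ => (soloBlindDecSet m M).map x) (fun M _ => ?_)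
    (fun M₁ h₁ M₂ h₂ he => ?_) (fun C hC => ?_) (fun M _ => ?_)
  · exact Finset.mem_powerset.mpr (Finset.map_subset_map.mpr (Finset.subset_univ _))
  · exact soloBlindDecSet_inj (Finset.mem_range.mp h₁) (Finset.mem_range.mp h₂)
      (Finset.map_injective x he)
  · obtain ⟨M, hM, hMC⟩ := soloBlind_exists_mask x (Finset.mem_powerset.mp hC)
    exact ⟨M, Finset.mem_range.mpr hM, hMC⟩
  · rw [Finset.card_map, Finset.sum_map]

omit [DecidableEq G] in
/-- Sums over "outside part plus block part". -/
theorem soloBlind_outside_block_sum (h : ι → G) {B : Finset ι} {m : ℕ} (x : Fin m ↪ ι)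
    (hxB : ∀ a, x a ∉ B) (T₀ : Finset (Fin m)) (A : Finset B) :
    T₀.map x ∪ A.map (Function.Embedding.subtype _) ⊆ B ∪ Finset.univ.map x ∧
      ∑ i ∈ T₀.map x ∪ A.map (Function.Embedding.subtype _), h i =
        ∑ a ∈ T₀, h (x a) + ∑ i ∈ A, h (i : ι) := by
  constructor
  · intro y hy
    rw [Finset.mem_union] at hy ⊢
    rcases hy with hy | hy
    · exact Or.inr (Finset.map_subset_map.mpr (Finset.subset_univ _) hy)
    · rw [Finset.mem_map] at hy
      obtain ⟨i, -, rfl⟩ := hy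
      exact Or.inl i.2
  · rw [Finset.sum_union, Finset.sum_map, Finset.sum_map]
    · rfl
    · rw [Finset.disjoint_left]
      intro y hy hy'
      rw [Finset.mem_map] at hy hy'
      obtain ⟨a, -, rfl⟩ := hy
      obtain ⟨i, -, hi⟩ := hy'
      apply hxB a
      rw [← hi]
      exact i.2

end Summit.MatrixMultiplication.MatrixMultiplication.Theorems
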